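import Mathlib.Algebra.BigOperators.Fin
import Mathlib.Tactic.FinCases
import Mathlib.Tactic.Ring
import Summits.HodgeConjecture.CorCM.Census.DihedralSexticFace

/-!
# The closure-12 sextic core `Y = B₀ × B₁ × B₂ × E`: the Hodge lattice of ALL power-products is spanned by pairs, the `k`-Weil sets of the fourfolds `Bₘ × E` and two FACES — kernel census

COR-CM (cell `pub-hodgecm2`), count-neutral sequel to seat b30's `Census/DihedralSexticFace.lean` (model: `K = k·F₀`, `F₀` a
non-cyclic totally real cubic, `Gal(L/ℚ) = S₃ × C₂` acting by `act` on the twenty points `Pt`, CM type `phi` of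
`Y = B₀ × B₁ × B₂ × E`; its census `B² = 75 = 45 + 30`, `30 = 6` `k`-Weil sets of the fourfolds `Bₘ × E` `+ 6` FACE sets
`X_{i,b}` `+ 18` sets on the ninefold `B₀ × B₁ × B₂`, and `span_certificate`: the `24` non-`k`-Weil sets are outside the
`ℚ`-span of divisor and `k`-Weil weights).  PORTFOLIO seat lit-andre-3 (gen 7), written with the species-basis method
of `Census/DihedralFourCoreLattice.lean` (the D₄ four-core); cell note `HOME/pub-hodgecm2-lit-andre-3/PORTFOLIO-lit-andre-3-g7.md`
§9.  No named fact, no geometry, no `sorry`: `rfl`, `decide`, `simp only`, `ring`, `omega`.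

WHAT THIS FILE DECIDES.
* §1 `kwSet m b`, `faceSet i b`, `pairOf x` by name (`families_eq`: = the first file's `kWeilSets`, `faceSets`, `conjPairs`,
  by `rfl`); `face_relations`: opposite signs give four conjugate pairs, and the FACE–WEIL RELATION
  `X_{0,b} + X_{1,b} + X_{2,b} = kw(0,b) + kw(1,b) + kw(2,b)`; `ninefold_reduction`: each of the `18` ninefold sets `N`
  satisfies `N ⊔ pair ⊔ pair(E) = X_{i,b} ⊔ kw(m,¬b)` (disjoint; explicit witnesses) — the ninefold classes are
  "face × Weil with two pairs deleted".
* §2 exponent vectors `m : Pt → ℤ` of power-products `B₀^a × B₁^b × B₂^c × E^d`, the twelve Hodge forms `hodgeForm g`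
  (`hodgeForm_wt`: `= 2|P ∩ g⁻¹Φ| − |P|` on indicators, i.e. the first file's `eq32`), expanded (`hodgeForm_expand`).
* §3 `isHodgeVec_iff` (LATTICE THEOREM): Hodge ⟺ integral combination of the FIFTEEN vectors {ten conjugate pairs,
  `kw(0,+)`, `kw(1,+)`, `kw(2,+)`, `X_{0,+}`, `X_{1,+}`}; `combo_eq_zero`: they are independent (rank `15`; the forms have
  rank `5`; `15 = 10 + rank L(Y)/MT(Y) = 10 + (3+3+3+1+1) − 6`).  From the exact oracle (`scratch/d6_species.py`, not
  re-decided): `⟨pairs, kw(B×E)⟩` has rank `13` and also contains the `k`-Weil pair sets of the sixfolds `Bₘ × Bₘ′`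
  (index `1`); each of `⟨pairs, kw, faces⟩`, `⟨pairs, kw, Nᵢ⟩` (`Nᵢ` any ONE of the three Galois orbits of ninefold sets),
  `⟨pairs, faces, N₁, N₂, N₃⟩` is the whole Hodge lattice (index `1`); `⟨pairs, kw, one face⟩` has rank `14` only (the
  six faces form ONE Galois orbit and are needed as a family), `⟨pairs, faces⟩` rank `13`, `⟨pairs, N₁, N₂, N₃⟩` rank `14`.
* §4 `isHodgeVec_iff_monoid` (MONOID FORM): for `m ≥ 0`, Hodge ⟺ `m + Σ q·pair = Σ n·kw + Σ f·X + Σ p·pair` with all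
  multiplicities non-negative (all six `kw(m,b)` and six `X_{i,b}` allowed).

THEOREM (cell note §9; geometric dictionary CITED as in the companion files, not formalised).  Let `K = k·F₀` be a sextic CM
field with normal closure of degree `12`, `B₀, B₁, B₂` the three pairwise non-isogenous Galois-conjugate simple CM
threefolds of the primitive types with one `+` (first file), `E` the CM elliptic curve of `k`.  For every abelian variety `Z`
isogenous to `B₀^a × B₁^b × B₂^c × E^d` (`a, b, c, d ≥ 0`), every Hodge class on `Z` is algebraic PROVIDED
  (W4) the `k`-Weil classes of the three abelian FOURFOLDS of Weil type `Bₘ × E` are algebraic — Markman's theorem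
       [cite: Markman2025SurveySecant, Thm 1.2], the cell's hypothesis `hW4`; and
  (F)  the `6`-dimensional face space `F(Y) ⊂ H⁴(B₀ × B₁ × B₂ × E, ℚ)` (Künneth type `(1,1,1,1)`, the monomials `X_{i,b}`,
       one Galois orbit) contains ONE non-zero algebraic class;
conversely (W4) and (F) are instances.  Equivalently, given (W4): HC for the whole tower ⟺ ONE non-zero algebraic class in
any one of the three `6`-dimensional Galois-orbit pieces `Nᵢ` of the exceptional classes of the NINEFOLD `B₀ × B₁ × B₂`.
So the "content beyond Markman" of the closure-12 sextic `K`-slice (first file, Reading) is exactly ONE class.  Proof: the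
operations (O1)–(O3) and the argument (O4) of `Census/DihedralFourCoreLattice.lean` verbatim (products, pull-backs,
push-forwards, CM endomorphisms and their `ℚ̄`-eigen-projectors, Jacobson density), except that the deletion (O3) of a
conjugate pair `{x, cx}` spread over two copies `i, j` of a factor of dimension `g` (`g = 3` for `Bₘ`, `g = 1` for `E`) cups
with the divisor `m_{ij}^*θ − pr_i^*θ − pr_j^*θ` AND with `pr_i^*θ^{g−1} · pr_j^*θ^{g−1}` before pushing forward along the two
copies (`e_x ∧ e_s ∧ θ^{g−1}` is a top class iff `s = cx`; for surfaces this is the companion file's `pr^*θ`); §4 of this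
file is the combinatorial input and the monomials of (W4), (F) and `NS(Bₘ) ⊗ ℚ̄`, `NS(E)` (the pairs) are the generators;
no standard-conjecture input. [cite: Pohlmann1968, Thm 1]

## References
* [Pohlmann1968] H. Pohlmann, Ann. of Math. 88 (1968) 161–180, Thm 1.  [GaoUllmo2025] Z. Gao, E. Ullmo, J. Inst. Math. Jussieu 25 (2025), Thm 3.1.
* [Deligne1982HodgeCycles] P. Deligne, Hodge cycles on abelian varieties, LNM 900 (1982), §5 (c) (Weil classes).
* [Markman2025SurveySecant] E. Markman, arXiv:2509.23403, Thm 1.2 (Weil classes on abelian fourfolds).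
* [Milne1999LefschetzClasses] J. S. Milne, Lefschetz classes on abelian varieties, Duke Math. J. 96 (1999), §4.

## Provenance
Exact oracle (pure python, < 2 s): seat folder `scratch/species.py` (generic: Hodge forms, integer kernel by HNF, index of
sublattices), `scratch/d6_species.py` (this configuration, index table), `scratch/gen_d6.py` (unimodular `15 × 15` minor on
`Pt ∖ {(0,0,+),(0,1,+),(0,2,+),(1,0,+),(1,1,+)}`, integral inverse = the witnesses; writes this file).  Kernel cost ≈ 50 s.
-/

namespace Summit.HodgeConjecture.CorCM.Census.DihedralSexticFace

open Finset

/-! ## §1 The generating families by name -/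

/-- The `k`-Weil set of the fourfold `Bₘ × E` of sign `b`: the `k`-fibre of slot `m` and the point of `E` of the same sign
(`kWeilSets` of the first file). [cite: Deligne1982HodgeCycles, §5 (c)] -/
def kwSet (m : Fin 3) (b : Bool) : Finset Pt := {Sum.inl (m, 0, b), Sum.inl (m, 1, b), Sum.inl (m, 2, b), Sum.inr b}

/-- The FACE set `X_{i,b}` (`faceSets` of the first file): one embedding of each threefold over the real place `i`, sign `b`,
and the point of `E` of sign `b`. [folklore] -/
def faceSet (i : ZMod 3) (b : Bool) : Finset Pt := {Sum.inl (0, i, b), Sum.inl (1, i, b), Sum.inl (2, i, b), Sum.inr b}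

/-- The conjugate pair through a point (a divisor-class monomial). [folklore] -/
def pairOf (x : Pt) : Finset Pt := {x, act 0 false false x}

/-- Bookkeeping against the first file. [folklore] -/
theorem families_eq : kWeilSets = univ.image (fun mb : Fin 3 × Bool => kwSet mb.1 mb.2) ∧
    faceSets = univ.image (fun ib : ZMod 3 × Bool => faceSet ib.1 ib.2) ∧ conjPairs = univ.image pairOf :=
  ⟨rfl, rfl, rfl⟩

set_option maxRecDepth 8000 in
/-- Opposite signs: `X_{i,b} ⊔ X_{i,¬b}` and `kw(m,b) ⊔ kw(m,¬b)` are disjoint unions of four conjugate pairs (so the complex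
conjugate of a face / `k`-Weil monomial is MINUS it modulo divisor classes), and the FACE–WEIL RELATION: for each sign,
`X_{0,b} + X_{1,b} + X_{2,b} = kw(0,b) + kw(1,b) + kw(2,b)` as multisets of points. [folklore] -/
theorem face_relations :
    (∀ i : ZMod 3, ∀ b : Bool, faceSet i b ∩ faceSet i (!b) = ∅ ∧
      faceSet i b ∪ faceSet i (!b) = pairOf (Sum.inl (0, i, true)) ∪ pairOf (Sum.inl (1, i, true)) ∪
        pairOf (Sum.inl (2, i, true)) ∪ pairOf (Sum.inr true)) ∧
    (∀ m : Fin 3, ∀ b : Bool, kwSet m b ∩ kwSet m (!b) = ∅ ∧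
      kwSet m b ∪ kwSet m (!b) = pairOf (Sum.inl (m, 0, true)) ∪ pairOf (Sum.inl (m, 1, true)) ∪
        pairOf (Sum.inl (m, 2, true)) ∪ pairOf (Sum.inr true)) ∧
    (∀ b : Bool, wt (faceSet 0 b) + wt (faceSet 1 b) + wt (faceSet 2 b) = wt (kwSet 0 b) + wt (kwSet 1 b) + wt (kwSet 2 b)) := by
  refine ⟨by decide +kernel, by decide +kernel, by decide +kernel⟩

set_option maxRecDepth 8000 in
/-- **THE NINEFOLD CLASSES ARE NOT A SEPARATE PROBLEM.**  Each of the eighteen exceptional `4`-sets on `B₀ × B₁ × B₂` alone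
(Künneth type `(2,1,1)`, first file), united with one conjugate pair of a threefold and the pair of `E`, is the DISJOINT
union of a face set and a `k`-Weil set of a fourfold `Bₘ × E`: `e_N · e_{pair} · e_{pair(E)} = ± e_{X_{i,b}} · e_{kw(m,¬b)}`.
With the deletion operation (O3) of `Census/DihedralFourCoreLattice.lean` this makes the ninefold classes algebraic as soon as
ONE face class is (modulo Markman's theorem for the fourfolds `Bₘ × E`). [folklore] -/
theorem ninefold_reduction :
    (faceSet 2 false ∩ kwSet 0 true = ∅ ∧ ({Sum.inl (0, 0, true), Sum.inl (0, 1, true), Sum.inl (1, 2, false), Sum.inl (2, 2, false)} : Finset Pt) ∩ (pairOf (Sum.inl (0, 2, true)) ∪ pairOf (Sum.inr true)) = ∅ ∧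
      ({Sum.inl (0, 0, true), Sum.inl (0, 1, true), Sum.inl (1, 2, false), Sum.inl (2, 2, false)} : Finset Pt) ∪ (pairOf (Sum.inl (0, 2, true)) ∪ pairOf (Sum.inr true)) = faceSet 2 false ∪ kwSet 0 true) ∧
    (faceSet 1 false ∩ kwSet 0 true = ∅ ∧ ({Sum.inl (0, 0, true), Sum.inl (0, 2, true), Sum.inl (1, 1, false), Sum.inl (2, 1, false)} : Finset Pt) ∩ (pairOf (Sum.inl (0, 1, true)) ∪ pairOf (Sum.inr true)) = ∅ ∧
      ({Sum.inl (0, 0, true), Sum.inl (0, 2, true), Sum.inl (1, 1, false), Sum.inl (2, 1, false)} : Finset Pt) ∪ (pairOf (Sum.inl (0, 1, true)) ∪ pairOf (Sum.inr true)) = faceSet 1 false ∪ kwSet 0 true) ∧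
    (faceSet 0 true ∩ kwSet 2 false = ∅ ∧ ({Sum.inl (0, 0, true), Sum.inl (1, 0, true), Sum.inl (2, 1, false), Sum.inl (2, 2, false)} : Finset Pt) ∩ (pairOf (Sum.inl (2, 0, true)) ∪ pairOf (Sum.inr true)) = ∅ ∧
      ({Sum.inl (0, 0, true), Sum.inl (1, 0, true), Sum.inl (2, 1, false), Sum.inl (2, 2, false)} : Finset Pt) ∪ (pairOf (Sum.inl (2, 0, true)) ∪ pairOf (Sum.inr true)) = faceSet 0 true ∪ kwSet 2 false) ∧
    (faceSet 0 true ∩ kwSet 1 false = ∅ ∧ ({Sum.inl (0, 0, true), Sum.inl (1, 1, false), Sum.inl (1, 2, false), Sum.inl (2, 0, true)} : Finset Pt) ∩ (pairOf (Sum.inl (1, 0, true)) ∪ pairOf (Sum.inr true)) = ∅ ∧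
      ({Sum.inl (0, 0, true), Sum.inl (1, 1, false), Sum.inl (1, 2, false), Sum.inl (2, 0, true)} : Finset Pt) ∪ (pairOf (Sum.inl (1, 0, true)) ∪ pairOf (Sum.inr true)) = faceSet 0 true ∪ kwSet 1 false) ∧
    (faceSet 2 true ∩ kwSet 0 false = ∅ ∧ ({Sum.inl (0, 0, false), Sum.inl (0, 1, false), Sum.inl (1, 2, true), Sum.inl (2, 2, true)} : Finset Pt) ∩ (pairOf (Sum.inl (0, 2, true)) ∪ pairOf (Sum.inr true)) = ∅ ∧
      ({Sum.inl (0, 0, false), Sum.inl (0, 1, false), Sum.inl (1, 2, true), Sum.inl (2, 2, true)} : Finset Pt) ∪ (pairOf (Sum.inl (0, 2, true)) ∪ pairOf (Sum.inr true)) = faceSet 2 true ∪ kwSet 0 false) ∧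
    (faceSet 1 true ∩ kwSet 0 false = ∅ ∧ ({Sum.inl (0, 0, false), Sum.inl (0, 2, false), Sum.inl (1, 1, true), Sum.inl (2, 1, true)} : Finset Pt) ∩ (pairOf (Sum.inl (0, 1, true)) ∪ pairOf (Sum.inr true)) = ∅ ∧
      ({Sum.inl (0, 0, false), Sum.inl (0, 2, false), Sum.inl (1, 1, true), Sum.inl (2, 1, true)} : Finset Pt) ∪ (pairOf (Sum.inl (0, 1, true)) ∪ pairOf (Sum.inr true)) = faceSet 1 true ∪ kwSet 0 false) ∧
    (faceSet 0 false ∩ kwSet 2 true = ∅ ∧ ({Sum.inl (0, 0, false), Sum.inl (1, 0, false), Sum.inl (2, 1, true), Sum.inl (2, 2, true)} : Finset Pt) ∩ (pairOf (Sum.inl (2, 0, true)) ∪ pairOf (Sum.inr true)) = ∅ ∧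
      ({Sum.inl (0, 0, false), Sum.inl (1, 0, false), Sum.inl (2, 1, true), Sum.inl (2, 2, true)} : Finset Pt) ∪ (pairOf (Sum.inl (2, 0, true)) ∪ pairOf (Sum.inr true)) = faceSet 0 false ∪ kwSet 2 true) ∧
    (faceSet 0 false ∩ kwSet 1 true = ∅ ∧ ({Sum.inl (0, 0, false), Sum.inl (1, 1, true), Sum.inl (1, 2, true), Sum.inl (2, 0, false)} : Finset Pt) ∩ (pairOf (Sum.inl (1, 0, true)) ∪ pairOf (Sum.inr true)) = ∅ ∧
      ({Sum.inl (0, 0, false), Sum.inl (1, 1, true), Sum.inl (1, 2, true), Sum.inl (2, 0, false)} : Finset Pt) ∪ (pairOf (Sum.inl (1, 0, true)) ∪ pairOf (Sum.inr true)) = faceSet 0 false ∪ kwSet 1 true) ∧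
    (faceSet 0 false ∩ kwSet 0 true = ∅ ∧ ({Sum.inl (0, 1, true), Sum.inl (0, 2, true), Sum.inl (1, 0, false), Sum.inl (2, 0, false)} : Finset Pt) ∩ (pairOf (Sum.inl (0, 0, true)) ∪ pairOf (Sum.inr true)) = ∅ ∧
      ({Sum.inl (0, 1, true), Sum.inl (0, 2, true), Sum.inl (1, 0, false), Sum.inl (2, 0, false)} : Finset Pt) ∪ (pairOf (Sum.inl (0, 0, true)) ∪ pairOf (Sum.inr true)) = faceSet 0 false ∪ kwSet 0 true) ∧
    (faceSet 1 true ∩ kwSet 1 false = ∅ ∧ ({Sum.inl (0, 1, true), Sum.inl (1, 0, false), Sum.inl (1, 2, false), Sum.inl (2, 1, true)} : Finset Pt) ∩ (pairOf (Sum.inl (1, 1, true)) ∪ pairOf (Sum.inr true)) = ∅ ∧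
      ({Sum.inl (0, 1, true), Sum.inl (1, 0, false), Sum.inl (1, 2, false), Sum.inl (2, 1, true)} : Finset Pt) ∪ (pairOf (Sum.inl (1, 1, true)) ∪ pairOf (Sum.inr true)) = faceSet 1 true ∪ kwSet 1 false) ∧
    (faceSet 1 true ∩ kwSet 2 false = ∅ ∧ ({Sum.inl (0, 1, true), Sum.inl (1, 1, true), Sum.inl (2, 0, false), Sum.inl (2, 2, false)} : Finset Pt) ∩ (pairOf (Sum.inl (2, 1, true)) ∪ pairOf (Sum.inr true)) = ∅ ∧
      ({Sum.inl (0, 1, true), Sum.inl (1, 1, true), Sum.inl (2, 0, false), Sum.inl (2, 2, false)} : Finset Pt) ∪ (pairOf (Sum.inl (2, 1, true)) ∪ pairOf (Sum.inr true)) = faceSet 1 true ∪ kwSet 2 false) ∧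
    (faceSet 0 true ∩ kwSet 0 false = ∅ ∧ ({Sum.inl (0, 1, false), Sum.inl (0, 2, false), Sum.inl (1, 0, true), Sum.inl (2, 0, true)} : Finset Pt) ∩ (pairOf (Sum.inl (0, 0, true)) ∪ pairOf (Sum.inr true)) = ∅ ∧
      ({Sum.inl (0, 1, false), Sum.inl (0, 2, false), Sum.inl (1, 0, true), Sum.inl (2, 0, true)} : Finset Pt) ∪ (pairOf (Sum.inl (0, 0, true)) ∪ pairOf (Sum.inr true)) = faceSet 0 true ∪ kwSet 0 false) ∧
    (faceSet 1 false ∩ kwSet 1 true = ∅ ∧ ({Sum.inl (0, 1, false), Sum.inl (1, 0, true), Sum.inl (1, 2, true), Sum.inl (2, 1, false)} : Finset Pt) ∩ (pairOf (Sum.inl (1, 1, true)) ∪ pairOf (Sum.inr true)) = ∅ ∧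
      ({Sum.inl (0, 1, false), Sum.inl (1, 0, true), Sum.inl (1, 2, true), Sum.inl (2, 1, false)} : Finset Pt) ∪ (pairOf (Sum.inl (1, 1, true)) ∪ pairOf (Sum.inr true)) = faceSet 1 false ∪ kwSet 1 true) ∧
    (faceSet 1 false ∩ kwSet 2 true = ∅ ∧ ({Sum.inl (0, 1, false), Sum.inl (1, 1, false), Sum.inl (2, 0, true), Sum.inl (2, 2, true)} : Finset Pt) ∩ (pairOf (Sum.inl (2, 1, true)) ∪ pairOf (Sum.inr true)) = ∅ ∧
      ({Sum.inl (0, 1, false), Sum.inl (1, 1, false), Sum.inl (2, 0, true), Sum.inl (2, 2, true)} : Finset Pt) ∪ (pairOf (Sum.inl (2, 1, true)) ∪ pairOf (Sum.inr true)) = faceSet 1 false ∪ kwSet 2 true) ∧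
    (faceSet 2 true ∩ kwSet 1 false = ∅ ∧ ({Sum.inl (0, 2, true), Sum.inl (1, 0, false), Sum.inl (1, 1, false), Sum.inl (2, 2, true)} : Finset Pt) ∩ (pairOf (Sum.inl (1, 2, true)) ∪ pairOf (Sum.inr true)) = ∅ ∧
      ({Sum.inl (0, 2, true), Sum.inl (1, 0, false), Sum.inl (1, 1, false), Sum.inl (2, 2, true)} : Finset Pt) ∪ (pairOf (Sum.inl (1, 2, true)) ∪ pairOf (Sum.inr true)) = faceSet 2 true ∪ kwSet 1 false) ∧
    (faceSet 2 true ∩ kwSet 2 false = ∅ ∧ ({Sum.inl (0, 2, true), Sum.inl (1, 2, true), Sum.inl (2, 0, false), Sum.inl (2, 1, false)} : Finset Pt) ∩ (pairOf (Sum.inl (2, 2, true)) ∪ pairOf (Sum.inr true)) = ∅ ∧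
      ({Sum.inl (0, 2, true), Sum.inl (1, 2, true), Sum.inl (2, 0, false), Sum.inl (2, 1, false)} : Finset Pt) ∪ (pairOf (Sum.inl (2, 2, true)) ∪ pairOf (Sum.inr true)) = faceSet 2 true ∪ kwSet 2 false) ∧
    (faceSet 2 false ∩ kwSet 1 true = ∅ ∧ ({Sum.inl (0, 2, false), Sum.inl (1, 0, true), Sum.inl (1, 1, true), Sum.inl (2, 2, false)} : Finset Pt) ∩ (pairOf (Sum.inl (1, 2, true)) ∪ pairOf (Sum.inr true)) = ∅ ∧
      ({Sum.inl (0, 2, false), Sum.inl (1, 0, true), Sum.inl (1, 1, true), Sum.inl (2, 2, false)} : Finset Pt) ∪ (pairOf (Sum.inl (1, 2, true)) ∪ pairOf (Sum.inr true)) = faceSet 2 false ∪ kwSet 1 true) ∧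
    (faceSet 2 false ∩ kwSet 2 true = ∅ ∧ ({Sum.inl (0, 2, false), Sum.inl (1, 2, false), Sum.inl (2, 0, true), Sum.inl (2, 1, true)} : Finset Pt) ∩ (pairOf (Sum.inl (2, 2, true)) ∪ pairOf (Sum.inr true)) = ∅ ∧
      ({Sum.inl (0, 2, false), Sum.inl (1, 2, false), Sum.inl (2, 0, true), Sum.inl (2, 1, true)} : Finset Pt) ∪ (pairOf (Sum.inl (2, 2, true)) ∪ pairOf (Sum.inr true)) = faceSet 2 false ∪ kwSet 2 true) := by
  refine ⟨?_, ?_, ?_, ?_, ?_, ?_, ?_, ?_, ?_, ?_, ?_, ?_, ?_, ?_, ?_, ?_, ?_, ?_⟩ <;> decide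

/-! ## §2 Exponent vectors of power-products `B₀^a × B₁^b × B₂^c × E^d` and the twelve linear Hodge forms -/

/-- Pohlmann's Hodge functional of `g = (rʲ sᶠ, cᵈ)` on exponent vectors `m : Pt → ℤ`: `Σ_x (2[g x ∈ Φ_Y] − 1)·m x`.
[cite: Pohlmann1968, Thm 1] [cite: GaoUllmo2025, Thm 3.1] -/
def hodgeForm (g : ZMod 3 × Bool × Bool) (m : Pt → ℤ) : ℤ :=
  ∑ x : Pt, (if act g.1 g.2.1 g.2.2 x ∈ phi then m x else -m x)

/-- Bridge to the set census: on the indicator `wt P` the functional is `2·|P ∩ g⁻¹Φ| − |P|` (so for `|P| = 2p` it vanishes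
iff `eq32 p P`). [cite: GaoUllmo2025, Thm 3.1 eq. (3.2)] -/
theorem hodgeForm_wt (g : ZMod 3 × Bool × Bool) (P : Finset Pt) :
    hodgeForm g (wt P) = 2 * ((P.filter fun x => act g.1 g.2.1 g.2.2 x ∈ phi).card : ℤ) - (P.card : ℤ) := by
  classical
  unfold hodgeForm wt
  have hsplit : ∀ x : Pt, (if act g.1 g.2.1 g.2.2 x ∈ phi then (if x ∈ P then (1 : ℤ) else 0) else -(if x ∈ P then (1 : ℤ) else 0))
      = (if x ∈ P.filter (fun x => act g.1 g.2.1 g.2.2 x ∈ phi) then (2 : ℤ) else 0) - (if x ∈ P then (1 : ℤ) else 0) := by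
    intro x
    by_cases h1 : act g.1 g.2.1 g.2.2 x ∈ phi <;> by_cases h2 : x ∈ P <;> simp [h1, h2]
  simp_rw [hsplit]
  rw [Finset.sum_sub_distrib, ← Finset.sum_filter, ← Finset.sum_filter, Finset.sum_const, Finset.sum_const]
  simp only [Finset.filter_mem_eq_inter, Finset.univ_inter, nsmul_eq_mul, mul_one]
  ring

/-- Sums over `ZMod 3 = Fin 3`. [folklore] -/
theorem sum_zmod3 (f : ZMod 3 → ℤ) : ∑ x : ZMod 3, f x = f 0 + f 1 + f 2 := Fin.sum_univ_three f

/-- Case analysis over the twenty points, in numeral form. [folklore] -/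
theorem forall_pt (p : Pt → Prop) :
    (∀ x, p x) ↔ p (Sum.inl (0, 0, true)) ∧ p (Sum.inl (0, 0, false)) ∧ p (Sum.inl (0, 1, true)) ∧ p (Sum.inl (0, 1, false)) ∧ p (Sum.inl (0, 2, true)) ∧ p (Sum.inl (0, 2, false)) ∧
      p (Sum.inl (1, 0, true)) ∧ p (Sum.inl (1, 0, false)) ∧ p (Sum.inl (1, 1, true)) ∧ p (Sum.inl (1, 1, false)) ∧ p (Sum.inl (1, 2, true)) ∧ p (Sum.inl (1, 2, false)) ∧
      p (Sum.inl (2, 0, true)) ∧ p (Sum.inl (2, 0, false)) ∧ p (Sum.inl (2, 1, true)) ∧ p (Sum.inl (2, 1, false)) ∧ p (Sum.inl (2, 2, true)) ∧ p (Sum.inl (2, 2, false)) ∧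
      p (Sum.inr true) ∧ p (Sum.inr false) := by
  constructor
  · intro h
    exact ⟨h _, h _, h _, h _, h _, h _, h _, h _, h _, h _, h _, h _, h _, h _, h _, h _, h _, h _, h _, h _⟩
  · rintro ⟨h0, h1, h2, h3, h4, h5, h6, h7, h8, h9, h10, h11, h12, h13, h14, h15, h16, h17, h18, h19⟩ (⟨m, i, b⟩ | b)
    · fin_cases m <;> fin_cases i <;> cases b <;> assumption
    · cases b <;> assumption

/-- Case analysis over the twelve group elements, in numeral form. [folklore] -/
theorem forall_d6 (p : ZMod 3 × Bool × Bool → Prop) :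
    (∀ g, p g) ↔ p (0, false, false) ∧ p (0, false, true) ∧ p (0, true, false) ∧ p (0, true, true) ∧ p (1, false, false) ∧ p (1, false, true) ∧
      p (1, true, false) ∧ p (1, true, true) ∧ p (2, false, false) ∧ p (2, false, true) ∧ p (2, true, false) ∧ p (2, true, true) := by
  constructor
  · intro h
    exact ⟨h _, h _, h _, h _, h _, h _, h _, h _, h _, h _, h _, h _⟩
  · rintro ⟨h0, h1, h2, h3, h4, h5, h6, h7, h8, h9, h10, h11⟩ ⟨j, f, d⟩
    fin_cases j <;> cases f <;> cases d <;> assumption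

/-- The twelve Hodge forms, expanded. [cite: Pohlmann1968, Thm 1] -/
theorem hodgeForm_expand (m : Pt → ℤ) :
    hodgeForm (0, false, false) m = -m (Sum.inl (0, 0, true)) + m (Sum.inl (0, 0, false)) + m (Sum.inl (0, 1, true)) - m (Sum.inl (0, 1, false)) + m (Sum.inl (0, 2, true)) - m (Sum.inl (0, 2, false)) + m (Sum.inl (1, 0, true)) - m (Sum.inl (1, 0, false)) - m (Sum.inl (1, 1, true)) + m (Sum.inl (1, 1, false)) + m (Sum.inl (1, 2, true)) - m (Sum.inl (1, 2, false)) + m (Sum.inl (2, 0, true)) - m (Sum.inl (2, 0, false)) + m (Sum.inl (2, 1, true)) - m (Sum.inl (2, 1, false)) - m (Sum.inl (2, 2, true)) + m (Sum.inl (2, 2, false)) - m (Sum.inr true) + m (Sum.inr false) ∧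
    hodgeForm (0, false, true) m = m (Sum.inl (0, 0, true)) - m (Sum.inl (0, 0, false)) - m (Sum.inl (0, 1, true)) + m (Sum.inl (0, 1, false)) - m (Sum.inl (0, 2, true)) + m (Sum.inl (0, 2, false)) - m (Sum.inl (1, 0, true)) + m (Sum.inl (1, 0, false)) + m (Sum.inl (1, 1, true)) - m (Sum.inl (1, 1, false)) - m (Sum.inl (1, 2, true)) + m (Sum.inl (1, 2, false)) - m (Sum.inl (2, 0, true)) + m (Sum.inl (2, 0, false)) - m (Sum.inl (2, 1, true)) + m (Sum.inl (2, 1, false)) + m (Sum.inl (2, 2, true)) - m (Sum.inl (2, 2, false)) + m (Sum.inr true) - m (Sum.inr false) ∧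
    hodgeForm (0, true, false) m = -m (Sum.inl (0, 0, true)) + m (Sum.inl (0, 0, false)) + m (Sum.inl (0, 1, true)) - m (Sum.inl (0, 1, false)) + m (Sum.inl (0, 2, true)) - m (Sum.inl (0, 2, false)) + m (Sum.inl (1, 0, true)) - m (Sum.inl (1, 0, false)) + m (Sum.inl (1, 1, true)) - m (Sum.inl (1, 1, false)) - m (Sum.inl (1, 2, true)) + m (Sum.inl (1, 2, false)) + m (Sum.inl (2, 0, true)) - m (Sum.inl (2, 0, false)) - m (Sum.inl (2, 1, true)) + m (Sum.inl (2, 1, false)) + m (Sum.inl (2, 2, true)) - m (Sum.inl (2, 2, false)) - m (Sum.inr true) + m (Sum.inr false) ∧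
    hodgeForm (0, true, true) m = m (Sum.inl (0, 0, true)) - m (Sum.inl (0, 0, false)) - m (Sum.inl (0, 1, true)) + m (Sum.inl (0, 1, false)) - m (Sum.inl (0, 2, true)) + m (Sum.inl (0, 2, false)) - m (Sum.inl (1, 0, true)) + m (Sum.inl (1, 0, false)) - m (Sum.inl (1, 1, true)) + m (Sum.inl (1, 1, false)) + m (Sum.inl (1, 2, true)) - m (Sum.inl (1, 2, false)) - m (Sum.inl (2, 0, true)) + m (Sum.inl (2, 0, false)) + m (Sum.inl (2, 1, true)) - m (Sum.inl (2, 1, false)) - m (Sum.inl (2, 2, true)) + m (Sum.inl (2, 2, false)) + m (Sum.inr true) - m (Sum.inr false) ∧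
    hodgeForm (1, false, false) m = m (Sum.inl (0, 0, true)) - m (Sum.inl (0, 0, false)) + m (Sum.inl (0, 1, true)) - m (Sum.inl (0, 1, false)) - m (Sum.inl (0, 2, true)) + m (Sum.inl (0, 2, false)) - m (Sum.inl (1, 0, true)) + m (Sum.inl (1, 0, false)) + m (Sum.inl (1, 1, true)) - m (Sum.inl (1, 1, false)) + m (Sum.inl (1, 2, true)) - m (Sum.inl (1, 2, false)) + m (Sum.inl (2, 0, true)) - m (Sum.inl (2, 0, false)) - m (Sum.inl (2, 1, true)) + m (Sum.inl (2, 1, false)) + m (Sum.inl (2, 2, true)) - m (Sum.inl (2, 2, false)) - m (Sum.inr true) + m (Sum.inr false) ∧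
    hodgeForm (1, false, true) m = -m (Sum.inl (0, 0, true)) + m (Sum.inl (0, 0, false)) - m (Sum.inl (0, 1, true)) + m (Sum.inl (0, 1, false)) + m (Sum.inl (0, 2, true)) - m (Sum.inl (0, 2, false)) + m (Sum.inl (1, 0, true)) - m (Sum.inl (1, 0, false)) - m (Sum.inl (1, 1, true)) + m (Sum.inl (1, 1, false)) - m (Sum.inl (1, 2, true)) + m (Sum.inl (1, 2, false)) - m (Sum.inl (2, 0, true)) + m (Sum.inl (2, 0, false)) + m (Sum.inl (2, 1, true)) - m (Sum.inl (2, 1, false)) - m (Sum.inl (2, 2, true)) + m (Sum.inl (2, 2, false)) + m (Sum.inr true) - m (Sum.inr false) ∧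
    hodgeForm (1, true, false) m = m (Sum.inl (0, 0, true)) - m (Sum.inl (0, 0, false)) - m (Sum.inl (0, 1, true)) + m (Sum.inl (0, 1, false)) + m (Sum.inl (0, 2, true)) - m (Sum.inl (0, 2, false)) - m (Sum.inl (1, 0, true)) + m (Sum.inl (1, 0, false)) + m (Sum.inl (1, 1, true)) - m (Sum.inl (1, 1, false)) + m (Sum.inl (1, 2, true)) - m (Sum.inl (1, 2, false)) + m (Sum.inl (2, 0, true)) - m (Sum.inl (2, 0, false)) + m (Sum.inl (2, 1, true)) - m (Sum.inl (2, 1, false)) - m (Sum.inl (2, 2, true)) + m (Sum.inl (2, 2, false)) - m (Sum.inr true) + m (Sum.inr false) ∧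
    hodgeForm (1, true, true) m = -m (Sum.inl (0, 0, true)) + m (Sum.inl (0, 0, false)) + m (Sum.inl (0, 1, true)) - m (Sum.inl (0, 1, false)) - m (Sum.inl (0, 2, true)) + m (Sum.inl (0, 2, false)) + m (Sum.inl (1, 0, true)) - m (Sum.inl (1, 0, false)) - m (Sum.inl (1, 1, true)) + m (Sum.inl (1, 1, false)) - m (Sum.inl (1, 2, true)) + m (Sum.inl (1, 2, false)) - m (Sum.inl (2, 0, true)) + m (Sum.inl (2, 0, false)) - m (Sum.inl (2, 1, true)) + m (Sum.inl (2, 1, false)) + m (Sum.inl (2, 2, true)) - m (Sum.inl (2, 2, false)) + m (Sum.inr true) - m (Sum.inr false) ∧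
    hodgeForm (2, false, false) m = m (Sum.inl (0, 0, true)) - m (Sum.inl (0, 0, false)) - m (Sum.inl (0, 1, true)) + m (Sum.inl (0, 1, false)) + m (Sum.inl (0, 2, true)) - m (Sum.inl (0, 2, false)) + m (Sum.inl (1, 0, true)) - m (Sum.inl (1, 0, false)) + m (Sum.inl (1, 1, true)) - m (Sum.inl (1, 1, false)) - m (Sum.inl (1, 2, true)) + m (Sum.inl (1, 2, false)) - m (Sum.inl (2, 0, true)) + m (Sum.inl (2, 0, false)) + m (Sum.inl (2, 1, true)) - m (Sum.inl (2, 1, false)) + m (Sum.inl (2, 2, true)) - m (Sum.inl (2, 2, false)) - m (Sum.inr true) + m (Sum.inr false) ∧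
    hodgeForm (2, false, true) m = -m (Sum.inl (0, 0, true)) + m (Sum.inl (0, 0, false)) + m (Sum.inl (0, 1, true)) - m (Sum.inl (0, 1, false)) - m (Sum.inl (0, 2, true)) + m (Sum.inl (0, 2, false)) - m (Sum.inl (1, 0, true)) + m (Sum.inl (1, 0, false)) - m (Sum.inl (1, 1, true)) + m (Sum.inl (1, 1, false)) + m (Sum.inl (1, 2, true)) - m (Sum.inl (1, 2, false)) + m (Sum.inl (2, 0, true)) - m (Sum.inl (2, 0, false)) - m (Sum.inl (2, 1, true)) + m (Sum.inl (2, 1, false)) - m (Sum.inl (2, 2, true)) + m (Sum.inl (2, 2, false)) + m (Sum.inr true) - m (Sum.inr false) ∧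
    hodgeForm (2, true, false) m = m (Sum.inl (0, 0, true)) - m (Sum.inl (0, 0, false)) + m (Sum.inl (0, 1, true)) - m (Sum.inl (0, 1, false)) - m (Sum.inl (0, 2, true)) + m (Sum.inl (0, 2, false)) + m (Sum.inl (1, 0, true)) - m (Sum.inl (1, 0, false)) - m (Sum.inl (1, 1, true)) + m (Sum.inl (1, 1, false)) + m (Sum.inl (1, 2, true)) - m (Sum.inl (1, 2, false)) - m (Sum.inl (2, 0, true)) + m (Sum.inl (2, 0, false)) + m (Sum.inl (2, 1, true)) - m (Sum.inl (2, 1, false)) + m (Sum.inl (2, 2, true)) - m (Sum.inl (2, 2, false)) - m (Sum.inr true) + m (Sum.inr false) ∧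
    hodgeForm (2, true, true) m = -m (Sum.inl (0, 0, true)) + m (Sum.inl (0, 0, false)) - m (Sum.inl (0, 1, true)) + m (Sum.inl (0, 1, false)) + m (Sum.inl (0, 2, true)) - m (Sum.inl (0, 2, false)) - m (Sum.inl (1, 0, true)) + m (Sum.inl (1, 0, false)) + m (Sum.inl (1, 1, true)) - m (Sum.inl (1, 1, false)) - m (Sum.inl (1, 2, true)) + m (Sum.inl (1, 2, false)) + m (Sum.inl (2, 0, true)) - m (Sum.inl (2, 0, false)) - m (Sum.inl (2, 1, true)) + m (Sum.inl (2, 1, false)) - m (Sum.inl (2, 2, true)) + m (Sum.inl (2, 2, false)) + m (Sum.inr true) - m (Sum.inr false) := by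
  refine ⟨?_, ?_, ?_, ?_, ?_, ?_, ?_, ?_, ?_, ?_, ?_, ?_⟩ <;>
  · simp (config := { decide := true }) only [hodgeForm, Fintype.sum_sum_type, Fintype.sum_prod_type, Fin.sum_univ_three,
      sum_zmod3, Fintype.sum_bool, ↓reduceIte]
    ring

/-! ## §3 The lattice theorem: Hodge exponent vectors = ℤ⟨10 pairs, kw(0,+), kw(1,+), kw(2,+), X_{0,+}, X_{1,+}⟩ -/

/-- Integral combinations of the fifteen generators (pairs `a0..a9` in the order `(m,i) = (0,0)..(2,2)`, `E`; the three
`k`-Weil sets of sign `+` (`w0 w1 w2`); the faces `X_{0,+}, X_{1,+}` (`x0 x1`)). [folklore] -/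
def combo (a0 a1 a2 a3 a4 a5 a6 a7 a8 a9 w0 w1 w2 x0 x1 : ℤ) (x : Pt) : ℤ :=
  a0 * wt (pairOf (Sum.inl (0, 0, true))) x + a1 * wt (pairOf (Sum.inl (0, 1, true))) x + a2 * wt (pairOf (Sum.inl (0, 2, true))) x +
  a3 * wt (pairOf (Sum.inl (1, 0, true))) x + a4 * wt (pairOf (Sum.inl (1, 1, true))) x + a5 * wt (pairOf (Sum.inl (1, 2, true))) x +
  a6 * wt (pairOf (Sum.inl (2, 0, true))) x + a7 * wt (pairOf (Sum.inl (2, 1, true))) x + a8 * wt (pairOf (Sum.inl (2, 2, true))) x +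
  a9 * wt (pairOf (Sum.inr true)) x + w0 * wt (kwSet 0 true) x + w1 * wt (kwSet 1 true) x +
  w2 * wt (kwSet 2 true) x + x0 * wt (faceSet 0 true) x + x1 * wt (faceSet 1 true) x

/-- `combo` at the twenty points. [folklore] -/
theorem combo_expand (a0 a1 a2 a3 a4 a5 a6 a7 a8 a9 w0 w1 w2 x0 x1 : ℤ) :
    combo a0 a1 a2 a3 a4 a5 a6 a7 a8 a9 w0 w1 w2 x0 x1 (Sum.inl (0, 0, true)) = a0 + w0 + x0 ∧
    combo a0 a1 a2 a3 a4 a5 a6 a7 a8 a9 w0 w1 w2 x0 x1 (Sum.inl (0, 0, false)) = a0 ∧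
    combo a0 a1 a2 a3 a4 a5 a6 a7 a8 a9 w0 w1 w2 x0 x1 (Sum.inl (0, 1, true)) = a1 + w0 + x1 ∧
    combo a0 a1 a2 a3 a4 a5 a6 a7 a8 a9 w0 w1 w2 x0 x1 (Sum.inl (0, 1, false)) = a1 ∧
    combo a0 a1 a2 a3 a4 a5 a6 a7 a8 a9 w0 w1 w2 x0 x1 (Sum.inl (0, 2, true)) = a2 + w0 ∧
    combo a0 a1 a2 a3 a4 a5 a6 a7 a8 a9 w0 w1 w2 x0 x1 (Sum.inl (0, 2, false)) = a2 ∧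
    combo a0 a1 a2 a3 a4 a5 a6 a7 a8 a9 w0 w1 w2 x0 x1 (Sum.inl (1, 0, true)) = a3 + w1 + x0 ∧
    combo a0 a1 a2 a3 a4 a5 a6 a7 a8 a9 w0 w1 w2 x0 x1 (Sum.inl (1, 0, false)) = a3 ∧
    combo a0 a1 a2 a3 a4 a5 a6 a7 a8 a9 w0 w1 w2 x0 x1 (Sum.inl (1, 1, true)) = a4 + w1 + x1 ∧
    combo a0 a1 a2 a3 a4 a5 a6 a7 a8 a9 w0 w1 w2 x0 x1 (Sum.inl (1, 1, false)) = a4 ∧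
    combo a0 a1 a2 a3 a4 a5 a6 a7 a8 a9 w0 w1 w2 x0 x1 (Sum.inl (1, 2, true)) = a5 + w1 ∧
    combo a0 a1 a2 a3 a4 a5 a6 a7 a8 a9 w0 w1 w2 x0 x1 (Sum.inl (1, 2, false)) = a5 ∧
    combo a0 a1 a2 a3 a4 a5 a6 a7 a8 a9 w0 w1 w2 x0 x1 (Sum.inl (2, 0, true)) = a6 + w2 + x0 ∧
    combo a0 a1 a2 a3 a4 a5 a6 a7 a8 a9 w0 w1 w2 x0 x1 (Sum.inl (2, 0, false)) = a6 ∧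
    combo a0 a1 a2 a3 a4 a5 a6 a7 a8 a9 w0 w1 w2 x0 x1 (Sum.inl (2, 1, true)) = a7 + w2 + x1 ∧
    combo a0 a1 a2 a3 a4 a5 a6 a7 a8 a9 w0 w1 w2 x0 x1 (Sum.inl (2, 1, false)) = a7 ∧
    combo a0 a1 a2 a3 a4 a5 a6 a7 a8 a9 w0 w1 w2 x0 x1 (Sum.inl (2, 2, true)) = a8 + w2 ∧
    combo a0 a1 a2 a3 a4 a5 a6 a7 a8 a9 w0 w1 w2 x0 x1 (Sum.inl (2, 2, false)) = a8 ∧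
    combo a0 a1 a2 a3 a4 a5 a6 a7 a8 a9 w0 w1 w2 x0 x1 (Sum.inr true) = a9 + w0 + w1 + w2 + x0 + x1 ∧
    combo a0 a1 a2 a3 a4 a5 a6 a7 a8 a9 w0 w1 w2 x0 x1 (Sum.inr false) = a9 := by
  refine ⟨?_, ?_, ?_, ?_, ?_, ?_, ?_, ?_, ?_, ?_, ?_, ?_, ?_, ?_, ?_, ?_, ?_, ?_, ?_, ?_⟩ <;>
  · simp (config := { decide := true }) only [combo, wt, ↓reduceIte]
    ring

set_option maxHeartbeats 800000 in
/-- **THE LATTICE THEOREM (closure-12 sextic).**  An integer exponent vector on `Y = B₀ × B₁ × B₂ × E` satisfies Pohlmann's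
Hodge condition for all of `S₃ × C₂` iff it is an integral combination of the ten conjugate pairs, the three `k`-Weil sets
`kw(m,+)` of the fourfolds `Bₘ × E` and the two faces `X_{0,+}, X_{1,+}`; with `combo_eq_zero` these fifteen are a basis
(Hodge lattice of rank `15`, `= 10 + rank L(Y)/MT(Y) = 10 + (11 − 6)`).  Exact oracle: `scratch/d6_species.py`, `gen_d6.py`.
[cite: Pohlmann1968, Thm 1] -/
theorem isHodgeVec_iff (m : Pt → ℤ) :
    (∀ g : ZMod 3 × Bool × Bool, hodgeForm g m = 0) ↔
      ∃ a0 a1 a2 a3 a4 a5 a6 a7 a8 a9 w0 w1 w2 x0 x1 : ℤ, ∀ x, m x = combo a0 a1 a2 a3 a4 a5 a6 a7 a8 a9 w0 w1 w2 x0 x1 x := by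
  constructor
  · intro h
    rw [forall_d6] at h
    simp only [hodgeForm_expand] at h
    obtain ⟨h0, h1, h2, h3, h4, h5, h6, h7, h8, h9, h10, h11⟩ := h
    refine ⟨m (Sum.inl (0, 0, false)), m (Sum.inl (0, 1, false)), m (Sum.inl (0, 2, false)), m (Sum.inl (1, 0, false)), m (Sum.inl (1, 1, false)), m (Sum.inl (1, 2, false)), m (Sum.inl (2, 0, false)), m (Sum.inl (2, 1, false)), m (Sum.inl (2, 2, false)), m (Sum.inr false), -m (Sum.inl (1, 2, true)) + m (Sum.inl (1, 2, false)) - m (Sum.inl (2, 0, true)) + m (Sum.inl (2, 0, false)) - m (Sum.inl (2, 1, true)) + m (Sum.inl (2, 1, false)) + m (Sum.inl (2, 2, true)) - m (Sum.inl (2, 2, false)) + m (Sum.inr true) - m (Sum.inr false), m (Sum.inl (1, 2, true)) - m (Sum.inl (1, 2, false)), m (Sum.inl (2, 2, true)) - m (Sum.inl (2, 2, false)), m (Sum.inl (2, 0, true)) - m (Sum.inl (2, 0, false)) - m (Sum.inl (2, 2, true)) + m (Sum.inl (2, 2, false)), m (Sum.inl (2, 1, true)) - m (Sum.inl (2, 1,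 false)) - m (Sum.inl (2, 2, true)) + m (Sum.inl (2, 2, false)), ?_⟩
    rw [forall_pt]
    simp only [combo_expand]
    refine ⟨?_, ?_, ?_, ?_, ?_, ?_, ?_, ?_, ?_, ?_, ?_, ?_, ?_, ?_, ?_, ?_, ?_, ?_, ?_, ?_⟩ <;> first | omega | trivial
  · rintro ⟨a0, a1, a2, a3, a4, a5, a6, a7, a8, a9, w0, w1, w2, x0, x1, hm⟩
    rw [forall_pt] at hm
    simp only [combo_expand] at hm
    obtain ⟨p0, p1, p2, p3, p4, p5, p6, p7, p8, p9, p10, p11, p12, p13, p14, p15, p16, p17, p18, p19⟩ := hm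
    rw [forall_d6]
    simp only [hodgeForm_expand]
    refine ⟨?_, ?_, ?_, ?_, ?_, ?_, ?_, ?_, ?_, ?_, ?_, ?_⟩ <;> omega

/-- The fifteen generators are linearly independent. [folklore] -/
theorem combo_eq_zero (a0 a1 a2 a3 a4 a5 a6 a7 a8 a9 w0 w1 w2 x0 x1 : ℤ) (h : ∀ x, combo a0 a1 a2 a3 a4 a5 a6 a7 a8 a9 w0 w1 w2 x0 x1 x = 0) :
    a0 = 0 ∧ a1 = 0 ∧ a2 = 0 ∧ a3 = 0 ∧ a4 = 0 ∧ a5 = 0 ∧ a6 = 0 ∧ a7 = 0 ∧ a8 = 0 ∧ a9 = 0 ∧ w0 = 0 ∧ w1 = 0 ∧ w2 = 0 ∧ x0 = 0 ∧ x1 = 0 := by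
  rw [forall_pt] at h
  simp only [combo_expand] at h
  omega

/-! ## §4 The monoid form: `k`-Weil sets (both signs) and faces with NON-NEGATIVE multiplicities, pairs on both sides -/

/-- All six `k`-Weil sets `kw(m,b)`, all six faces `X_{i,b}` and the ten pairs with coefficients, at a point. [folklore] -/
def monoidCombo (n0 n1 n2 n3 n4 n5 f0 f1 f2 f3 f4 f5 p0 p1 p2 p3 p4 p5 p6 p7 p8 p9 : ℤ) (x : Pt) : ℤ :=
  n0 * wt (kwSet 0 true) x + n1 * wt (kwSet 0 false) x + n2 * wt (kwSet 1 true) x +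
  n3 * wt (kwSet 1 false) x + n4 * wt (kwSet 2 true) x + n5 * wt (kwSet 2 false) x +
  f0 * wt (faceSet 0 true) x + f1 * wt (faceSet 0 false) x + f2 * wt (faceSet 1 true) x +
  f3 * wt (faceSet 1 false) x + f4 * wt (faceSet 2 true) x + f5 * wt (faceSet 2 false) x +
  p0 * wt (pairOf (Sum.inl (0, 0, true))) x + p1 * wt (pairOf (Sum.inl (0, 1, true))) x + p2 * wt (pairOf (Sum.inl (0, 2, true))) x +
  p3 * wt (pairOf (Sum.inl (1, 0, true))) x + p4 * wt (pairOf (Sum.inl (1, 1, true))) x + p5 * wt (pairOf (Sum.inl (1, 2, true))) x +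
  p6 * wt (pairOf (Sum.inl (2, 0, true))) x + p7 * wt (pairOf (Sum.inl (2, 1, true))) x + p8 * wt (pairOf (Sum.inl (2, 2, true))) x +
  p9 * wt (pairOf (Sum.inr true)) x

/-- `monoidCombo` at the twenty points. [folklore] -/
theorem monoidCombo_expand (n0 n1 n2 n3 n4 n5 f0 f1 f2 f3 f4 f5 p0 p1 p2 p3 p4 p5 p6 p7 p8 p9 : ℤ) :
    monoidCombo n0 n1 n2 n3 n4 n5 f0 f1 f2 f3 f4 f5 p0 p1 p2 p3 p4 p5 p6 p7 p8 p9 (Sum.inl (0, 0, true)) = n0 + f0 + p0 ∧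
    monoidCombo n0 n1 n2 n3 n4 n5 f0 f1 f2 f3 f4 f5 p0 p1 p2 p3 p4 p5 p6 p7 p8 p9 (Sum.inl (0, 0, false)) = n1 + f1 + p0 ∧
    monoidCombo n0 n1 n2 n3 n4 n5 f0 f1 f2 f3 f4 f5 p0 p1 p2 p3 p4 p5 p6 p7 p8 p9 (Sum.inl (0, 1, true)) = n0 + f2 + p1 ∧
    monoidCombo n0 n1 n2 n3 n4 n5 f0 f1 f2 f3 f4 f5 p0 p1 p2 p3 p4 p5 p6 p7 p8 p9 (Sum.inl (0, 1, false)) = n1 + f3 + p1 ∧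
    monoidCombo n0 n1 n2 n3 n4 n5 f0 f1 f2 f3 f4 f5 p0 p1 p2 p3 p4 p5 p6 p7 p8 p9 (Sum.inl (0, 2, true)) = n0 + f4 + p2 ∧
    monoidCombo n0 n1 n2 n3 n4 n5 f0 f1 f2 f3 f4 f5 p0 p1 p2 p3 p4 p5 p6 p7 p8 p9 (Sum.inl (0, 2, false)) = n1 + f5 + p2 ∧
    monoidCombo n0 n1 n2 n3 n4 n5 f0 f1 f2 f3 f4 f5 p0 p1 p2 p3 p4 p5 p6 p7 p8 p9 (Sum.inl (1, 0, true)) = n2 + f0 + p3 ∧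
    monoidCombo n0 n1 n2 n3 n4 n5 f0 f1 f2 f3 f4 f5 p0 p1 p2 p3 p4 p5 p6 p7 p8 p9 (Sum.inl (1, 0, false)) = n3 + f1 + p3 ∧
    monoidCombo n0 n1 n2 n3 n4 n5 f0 f1 f2 f3 f4 f5 p0 p1 p2 p3 p4 p5 p6 p7 p8 p9 (Sum.inl (1, 1, true)) = n2 + f2 + p4 ∧
    monoidCombo n0 n1 n2 n3 n4 n5 f0 f1 f2 f3 f4 f5 p0 p1 p2 p3 p4 p5 p6 p7 p8 p9 (Sum.inl (1, 1, false)) = n3 + f3 + p4 ∧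
    monoidCombo n0 n1 n2 n3 n4 n5 f0 f1 f2 f3 f4 f5 p0 p1 p2 p3 p4 p5 p6 p7 p8 p9 (Sum.inl (1, 2, true)) = n2 + f4 + p5 ∧
    monoidCombo n0 n1 n2 n3 n4 n5 f0 f1 f2 f3 f4 f5 p0 p1 p2 p3 p4 p5 p6 p7 p8 p9 (Sum.inl (1, 2, false)) = n3 + f5 + p5 ∧
    monoidCombo n0 n1 n2 n3 n4 n5 f0 f1 f2 f3 f4 f5 p0 p1 p2 p3 p4 p5 p6 p7 p8 p9 (Sum.inl (2, 0, true)) = n4 + f0 + p6 ∧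
    monoidCombo n0 n1 n2 n3 n4 n5 f0 f1 f2 f3 f4 f5 p0 p1 p2 p3 p4 p5 p6 p7 p8 p9 (Sum.inl (2, 0, false)) = n5 + f1 + p6 ∧
    monoidCombo n0 n1 n2 n3 n4 n5 f0 f1 f2 f3 f4 f5 p0 p1 p2 p3 p4 p5 p6 p7 p8 p9 (Sum.inl (2, 1, true)) = n4 + f2 + p7 ∧
    monoidCombo n0 n1 n2 n3 n4 n5 f0 f1 f2 f3 f4 f5 p0 p1 p2 p3 p4 p5 p6 p7 p8 p9 (Sum.inl (2, 1, false)) = n5 + f3 + p7 ∧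
    monoidCombo n0 n1 n2 n3 n4 n5 f0 f1 f2 f3 f4 f5 p0 p1 p2 p3 p4 p5 p6 p7 p8 p9 (Sum.inl (2, 2, true)) = n4 + f4 + p8 ∧
    monoidCombo n0 n1 n2 n3 n4 n5 f0 f1 f2 f3 f4 f5 p0 p1 p2 p3 p4 p5 p6 p7 p8 p9 (Sum.inl (2, 2, false)) = n5 + f5 + p8 ∧
    monoidCombo n0 n1 n2 n3 n4 n5 f0 f1 f2 f3 f4 f5 p0 p1 p2 p3 p4 p5 p6 p7 p8 p9 (Sum.inr true) = n0 + n2 + n4 + f0 + f2 + f4 + p9 ∧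
    monoidCombo n0 n1 n2 n3 n4 n5 f0 f1 f2 f3 f4 f5 p0 p1 p2 p3 p4 p5 p6 p7 p8 p9 (Sum.inr false) = n1 + n3 + n5 + f1 + f3 + f5 + p9 := by
  refine ⟨?_, ?_, ?_, ?_, ?_, ?_, ?_, ?_, ?_, ?_, ?_, ?_, ?_, ?_, ?_, ?_, ?_, ?_, ?_, ?_⟩ <;>
  · simp (config := { decide := true }) only [monoidCombo, wt, ↓reduceIte]
    ring

set_option maxHeartbeats 800000 in
/-- **MONOID FORM.**  For a non-negative exponent vector `m` (a class monomial on some `B₀^a × B₁^b × B₂^c × E^d`):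
Hodge ⟺ `m + Σ q·pair = Σ n·kw + Σ f·X + Σ p·pair` with all multiplicities `n, f, p, q ≥ 0` — the combinatorial content of
"HC for every power-product ⟸ (Weil classes of the three fourfolds `Bₘ × E`, Markman) ∧ (ONE face class)" (module
docstring). [cite: Pohlmann1968, Thm 1] -/
theorem isHodgeVec_iff_monoid (m : Pt → ℤ) (hm : ∀ x, 0 ≤ m x) :
    (∀ g : ZMod 3 × Bool × Bool, hodgeForm g m = 0) ↔
      ∃ n0 n1 n2 n3 n4 n5 f0 f1 f2 f3 f4 f5 p0 p1 p2 p3 p4 p5 p6 p7 p8 p9 q0 q1 q2 q3 q4 q5 q6 q7 q8 q9 : ℤ,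
      (0 ≤ n0 ∧ 0 ≤ n1 ∧ 0 ≤ n2 ∧ 0 ≤ n3 ∧ 0 ≤ n4 ∧ 0 ≤ n5 ∧ 0 ≤ f0 ∧ 0 ≤ f1 ∧ 0 ≤ f2 ∧ 0 ≤ f3 ∧ 0 ≤ f4 ∧ 0 ≤ f5 ∧
       0 ≤ p0 ∧ 0 ≤ p1 ∧ 0 ≤ p2 ∧ 0 ≤ p3 ∧ 0 ≤ p4 ∧ 0 ≤ p5 ∧ 0 ≤ p6 ∧ 0 ≤ p7 ∧ 0 ≤ p8 ∧ 0 ≤ p9 ∧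
       0 ≤ q0 ∧ 0 ≤ q1 ∧ 0 ≤ q2 ∧ 0 ≤ q3 ∧ 0 ≤ q4 ∧ 0 ≤ q5 ∧ 0 ≤ q6 ∧ 0 ≤ q7 ∧ 0 ≤ q8 ∧ 0 ≤ q9) ∧
      ∀ x, m x + monoidCombo 0 0 0 0 0 0 0 0 0 0 0 0 q0 q1 q2 q3 q4 q5 q6 q7 q8 q9 x = monoidCombo n0 n1 n2 n3 n4 n5 f0 f1 f2 f3 f4 f5 p0 p1 p2 p3 p4 p5 p6 p7 p8 p9 x := by
  rw [isHodgeVec_iff]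
  rw [forall_pt] at hm
  obtain ⟨z0, z1, z2, z3, z4, z5, z6, z7, z8, z9, z10, z11, z12, z13, z14, z15, z16, z17, z18, z19⟩ := hm
  constructor
  · rintro ⟨a0, a1, a2, a3, a4, a5, a6, a7, a8, a9, w0, w1, w2, x0, x1, h⟩
    rw [forall_pt] at h
    simp only [combo_expand] at h
    obtain ⟨g0, g1, g2, g3, g4, g5, g6, g7, g8, g9, g10, g11, g12, g13, g14, g15, g16, g17, g18, g19⟩ := h
    refine ⟨max w0 0, max (-w0) 0, max w1 0, max (-w1) 0, max w2 0, max (-w2) 0, max x0 0, max (-x0) 0, max x1 0, max (-x1) 0, 0, 0, max (a0 - max (-w0) 0 - max (-x0) 0) 0, max (a1 - max (-w0) 0 - max (-x1) 0) 0, max (a2 - max (-w0) 0) 0, max (a3 - max (-w1) 0 - max (-x0) 0) 0, max (a4 - max (-w1) 0 - max (-x1) 0) 0, max (a5 - max (-w1) 0) 0, max (a6 - max (-w2) 0 - max (-x0) 0) 0, max (a7 - max (-w2) 0 - max (-x1) 0) 0, max (a8 - max (-w2) 0) 0, max (a9 - max (-w0) 0 - max (-w1) 0 - max (-w2) 0 -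 max (-x0) 0 - max (-x1) 0) 0, max (-(a0 - max (-w0) 0 - max (-x0) 0)) 0, max (-(a1 - max (-w0) 0 - max (-x1) 0)) 0, max (-(a2 - max (-w0) 0)) 0, max (-(a3 - max (-w1) 0 - max (-x0) 0)) 0, max (-(a4 - max (-w1) 0 - max (-x1) 0)) 0, max (-(a5 - max (-w1) 0)) 0, max (-(a6 - max (-w2) 0 - max (-x0) 0)) 0, max (-(a7 - max (-w2) 0 - max (-x1) 0)) 0, max (-(a8 - max (-w2) 0)) 0, max (-(a9 - max (-w0) 0 - max (-w1) 0 - max (-w2) 0 - max (-x0) 0 - max (-x1) 0)) 0, ?_, ?_⟩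
    · exact ⟨le_max_right _ _, le_max_right _ _, le_max_right _ _, le_max_right _ _, le_max_right _ _, le_max_right _ _, le_max_right _ _, le_max_right _ _, le_max_right _ _, le_max_right _ _, le_rfl, le_rfl, le_max_right _ _, le_max_right _ _, le_max_right _ _, le_max_right _ _, le_max_right _ _, le_max_right _ _, le_max_right _ _, le_max_right _ _, le_max_right _ _, le_max_right _ _, le_max_right _ _, le_max_right _ _, le_max_right _ _, le_max_right _ _, le_max_right _ _, le_max_right _ _, le_max_right _ _, le_max_right _ _, le_max_right _ _, le_max_right _ _⟩
    · rw [forall_pt]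
      simp only [monoidCombo_expand]
      refine ⟨?_, ?_, ?_, ?_, ?_, ?_, ?_, ?_, ?_, ?_, ?_, ?_, ?_, ?_, ?_, ?_, ?_, ?_, ?_, ?_⟩ <;> omega
  · rintro ⟨n0, n1, n2, n3, n4, n5, f0, f1, f2, f3, f4, f5, p0, p1, p2, p3, p4, p5, p6, p7, p8, p9, q0, q1, q2, q3, q4, q5, q6, q7, q8, q9, -, h⟩
    rw [forall_pt] at h
    simp only [monoidCombo_expand] at h
    obtain ⟨g0, g1, g2, g3, g4, g5, g6, g7, g8, g9, g10, g11, g12, g13, g14, g15, g16, g17, g18, g19⟩ := h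
    refine ⟨p0 - q0 + n1 + f1, p1 - q1 + n1 + f3, p2 - q2 + n1 + f5, p3 - q3 + n3 + f1, p4 - q4 + n3 + f3, p5 - q5 + n3 + f5, p6 - q6 + n5 + f1, p7 - q7 + n5 + f3, p8 - q8 + n5 + f5, p9 - q9 + n1 + n3 + n5 + f1 + f3 + f5, n0 - n1 + f4 - f5, n2 - n3 + f4 - f5, n4 - n5 + f4 - f5, f0 - f1 - f4 + f5, f2 - f3 - f4 + f5, ?_⟩
    rw [forall_pt]
    simp only [combo_expand]
    refine ⟨?_, ?_, ?_, ?_, ?_, ?_, ?_, ?_, ?_, ?_, ?_, ?_, ?_, ?_, ?_, ?_, ?_, ?_, ?_, ?_⟩ <;> omega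

end Summit.HodgeConjecture.CorCM.Census.DihedralSexticFace
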